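import Literature.Algebra.Homology.DiscreteRepExtInternalHomPostcomp
import Literature.Algebra.Homology.DiscreteRepStandardResolutionPullback

/-!
# The comparison `Extⁿ_{C_Γ}(N, X) ≃+ Extⁿ_{C_Γ}(triv k, Hom(N, X)) ≃+ Hⁿ_cont(Γ, Hom(N, X))` commutes
# with PULLBACK along any continuous homomorphism `φ : H → Γ` and a coefficient map `f : φ^*X → Y`

Topic `Algebra/Homology`; namespace `Literature.Algebra.Homology.DiscreteRep`.  Theorems, two `def`s
(the isomorphisms `pullIhomIso : φ^* Hom(N, P) ≅ Hom(φ^*N, φ^*P)` — identity on carriers, the two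
conjugation actions agree by `map_inv` but not definitionally — and `pullIhomComplexIso`) and `abbrev`s
(cochain maps); no named fact, no instance, no `sorry`.  Sequel of door-c4's `DiscreteRepExtInternalHom` (`extIhomAddEquiv N X hX hN n`,
engine ∘ curry ∘ engine, and `extIhomAddEquivContinuousCohomology`), of
`DiscreteRepStandardResolutionPullback` (`pullD k φ`, `stdComplexPullbackMap`, `stdη_pullback`,
`extTrivAddEquivContinuousCohomology_resDHom`) and of `ExtOfResolutionComparisonMap` (the comparison
map `θ` of an arbitrary exact augmented complex: `homologyToExt_map`, `homologyToExt_naturality`,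
`homologyToExt_extAddEquivHomologySucc`, `extAddEquivHomologySucc_homologyToExt`).  The file is the
pullback analogue of `DiscreteRepExtInternalHomRestriction` (restriction to a subgroup, seat
bsd-line-x1-p1-w3) and follows its three-factor structure; the difference is that for a NON-injective
`φ` the pulled-back standard complexes are exact but NOT acyclic, so the two engines are moved by `θ`
instead of by `extAddEquivHomologySucc_map/_naturality` — no acyclicity input beyond door-c4's `hN`
over `Γ` and `hN'` over `H`.

THE MATHEMATICS.  For compact groups `Γ`, `H`, a continuous homomorphism `φ : H → Γ`, `N ∈ C_Γ`
finitely generated over `k`, `X` (resp. `Y`) a discrete topological `Γ`- (resp. `H`-)representation and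
`f : φ^*X → Y`, the map `x ↦ f_*(φ^* x) : Extⁿ_{C_Γ}(N, X) → Extⁿ_{C_H}(φ^*N, Y)` corresponds under the
comparisons `Extⁿ(N, X) ≃+ Extⁿ(triv k, Hom(N, X))` (Harari Prop. 16.16 (b) / Milne I 0.8) to
`u ↦ Hom(φ^*N, f)_*(φ^* u)` — through `φ^* Hom(N, X) ≅ Hom(φ^*N, φ^*X)` (`pullIhomIso`) — and under
`Extⁿ(triv k, ·) ≃+ Hⁿ_cont` to Mathlib's `ContinuousCohomology.map φ g` for the corresponding map `g` of
topological representations (Harari §1.5: the map `f^*` of a compatible pair).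

MAIN RESULTS: `curryExt₀_resDHom`, `extComplexCurryIso_hom_resDHom`, `extAddEquivStdHomology_resDHom`,
`extTrivIhomAddEquivHomology_resDHom`, **`extIhomAddEquiv_resDHom`**:
`Hom(φ^*N, f)_* (φ^* (extIhomAddEquiv N X x)) = extIhomAddEquiv (φ^*N) Y (f_* (φ^* x))`, and
**`extIhomAddEquivContinuousCohomology_resDHom`**: `Hⁿ(φ, g) (cmp_X x) = cmp_Y (f_* (φ^* x))`.
Written for the background lane «PT-Ш-S-TC» of crux `stmt-BirchSwinnertonDyer-19032` (cell bsd-eis,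
seat bsd-line-x1-p1-w7 gen 13): the pull-back half of the local square (Λ1) for the comparison `cmp`
of Milne's `Ext` road, along the non-injective `Γ_{K_v} → Γ_K ↠ G_S`.  HONEST FRAMING: homological
algebra only; no duality theorem and no case of BSD is proved here.

## References
* D. Harari, *Galois Cohomology and Class Field Theory*, Universitext (2020), §16.2 Prop. 16.16 (b)
  (p. 271), Theorem 16.14 (proof, (16.2)), §1.5 Definition 1.33 (compatible pairs), §4.3 (2) and
  Remark 4.24. [Harari2020]
* J. S. Milne, *Arithmetic Duality Theorems*, 2nd ed. (2006), I §0 Example 0.8. [MilneADT2006]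
* C. A. Weibel, *An introduction to homological algebra* (1994), §2.4, Thm. 2.7.6. [Weibel1994]
-/

noncomputable section

universe u

namespace Literature.Algebra.Homology

namespace DiscreteRep

open CategoryTheory CategoryTheory.Limits CategoryTheory.Abelian TopRep ContinuousCohomology

variable {k Γ H : Type u} [CommRing k] [TopologicalSpace k] [Group Γ] [TopologicalSpace Γ]
  [IsTopologicalGroup Γ] [CompactSpace Γ] [Group H] [TopologicalSpace H] [IsTopologicalGroup H]
  [CompactSpace H] (φ : H →ₜ* Γ)

/-! ## §1 `φ^* Hom(N, P) ≅ Hom(φ^*N, φ^*P)` and curry under pullback -/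

section Curry

variable (N : DiscreteRepCat k Γ) [hNfin : Module.Finite k N.obj.V] [hNfin' : Module.Finite k ((pullD k φ).obj N).obj.V]
  (P : DiscreteRepCat k Γ)

omit [TopologicalSpace k] [IsTopologicalGroup Γ] [CompactSpace Γ] [IsTopologicalGroup H] [CompactSpace H] hNfin' in
/-- `φ^*N` has the same module of vectors as `N`, so it is finitely generated when `N` is (the instance binder
`[Module.Finite k ((pullD k φ).obj N).obj.V]` used below can always be supplied by this term).
[cite: Harari2020, §16.2 Remark 16.13] -/
theorem moduleFinite_pullD : Module.Finite k ((pullD k φ).obj N).obj.V := hNfin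

omit [TopologicalSpace k] [CompactSpace Γ] [CompactSpace H] in
/-- The two conjugation actions on the linear maps `N → P` — `φ^*` of `Hom(N, P)`
(`F ↦ ρ_P(φ g) ∘ F ∘ ρ_N((φ g)⁻¹)`) and `Hom(φ^*N, φ^*P)` (`F ↦ ρ_P(φ g) ∘ F ∘ ρ_N(φ(g⁻¹))`) — agree
(`map_inv`; they are not definitionally equal for a general `φ`). [cite: Harari2020, §16.2 Definition 16.10 and §4.3 (2)] -/
theorem pullD_ihomObj_ρ_apply (g : H) (F : N.obj.V →ₗ[k] P.obj.V) :
    ((pullD k φ).obj (ihomObj N P)).obj.ρ g F = (ihomObj ((pullD k φ).obj N) ((pullD k φ).obj P)).obj.ρ g F := by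
  change P.obj.ρ ((φ : H →* Γ) g) ∘ₗ F ∘ₗ N.obj.ρ (((φ : H →* Γ) g)⁻¹) =
    P.obj.ρ ((φ : H →* Γ) g) ∘ₗ F ∘ₗ N.obj.ρ ((φ : H →* Γ) (g⁻¹))
  rw [map_inv (φ : H →* Γ) g]

omit [TopologicalSpace k] [CompactSpace Γ] [CompactSpace H] in
/-- **`φ^* Hom(N, P) ≅ Hom(φ^*N, φ^*P)` in `C_H`** — the identity on the underlying linear maps.
[cite: Harari2020, §16.2 Definition 16.10 and §4.3 (2)] -/
def pullIhomIso : (pullD k φ).obj (ihomObj N P) ≅ ihomObj ((pullD k φ).obj N) ((pullD k φ).obj P) where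
  hom := ObjectProperty.homMk (Rep.ofHom ⟨LinearMap.id, fun g => LinearMap.ext fun F => by
    change ((pullD k φ).obj (ihomObj N P)).obj.ρ g F =
      (ihomObj ((pullD k φ).obj N) ((pullD k φ).obj P)).obj.ρ g F
    exact pullD_ihomObj_ρ_apply φ N P g F⟩)
  inv := ObjectProperty.homMk (Rep.ofHom ⟨LinearMap.id, fun g => LinearMap.ext fun F => by
    change (ihomObj ((pullD k φ).obj N) ((pullD k φ).obj P)).obj.ρ g F =
      ((pullD k φ).obj (ihomObj N P)).obj.ρ g F
    exact (pullD_ihomObj_ρ_apply φ N P g F).symm⟩)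
  hom_inv_id := rfl
  inv_hom_id := rfl

omit [TopologicalSpace k] [CompactSpace Γ] [CompactSpace H] in
/-- `pullIhomIso` is the identity on underlying linear maps. [cite: Harari2020, §16.2 Definition 16.10] -/
@[simp]
theorem pullIhomIso_hom_apply (F : N.obj.V →ₗ[k] P.obj.V) : (pullIhomIso φ N P).hom.hom.hom F = F := rfl

omit [TopologicalSpace k] [CompactSpace Γ] [CompactSpace H] in
/-- `pullIhomIso⁻¹` is the identity on underlying linear maps. [cite: Harari2020, §16.2 Definition 16.10] -/
@[simp]
theorem pullIhomIso_inv_apply (F : N.obj.V →ₗ[k] P.obj.V) : (pullIhomIso φ N P).inv.hom.hom F = F := rfl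

omit [TopologicalSpace k] [CompactSpace Γ] [CompactSpace H] in
variable {P} in
/-- **Naturality of `pullIhomIso` in `P`**: `φ^*(Hom(N, h)) ≫ iso = iso ≫ Hom(φ^*N, φ^*h)`.
[cite: Harari2020, §16.2 Definition 16.11] -/
@[reassoc]
theorem pullD_map_ihomFunctor_map {Q : DiscreteRepCat k Γ} (h : P ⟶ Q) :
    (pullD k φ).map ((ihomFunctor N).map h) ≫ (pullIhomIso φ N Q).hom =
      (pullIhomIso φ N P).hom ≫ (ihomFunctor ((pullD k φ).obj N)).map ((pullD k φ).map h) :=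
  rfl

omit [TopologicalSpace k] [CompactSpace Γ] [CompactSpace H] in
variable {P} in
/-- `φ^* (curry f) ≫ iso = curry (φ^* f)` on `Hom`-level. [cite: Harari2020, §16.2 Theorem 16.14 (proof, (16.2))] -/
theorem pullD_map_curryHom (f : N ⟶ P) :
    (pullD k φ).map (curryHom N f) ≫ (pullIhomIso φ N P).hom =
      curryHom ((pullD k φ).obj N) ((pullD k φ).map f) :=
  rfl

omit [TopologicalSpace k] [CompactSpace Γ] [CompactSpace H] in
variable {P} in
/-- **`curryExt₀` commutes with pullback**: `φ^* (curry x) ∘ iso = curry (φ^* x)` on `Ext⁰`.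
[cite: Harari2020, §16.2 Theorem 16.14 (proof, (16.2)) and §4.3 (2)] -/
theorem curryExt₀_resDHom (x : Ext N P 0) :
    ((curryExt₀ N P x).mapExactFunctor (pullD k φ)).comp (Ext.mk₀ (pullIhomIso φ N P).hom) (add_zero 0) =
      curryExt₀ ((pullD k φ).obj N) ((pullD k φ).obj P) (x.mapExactFunctor (pullD k φ)) := by
  obtain ⟨f, rfl⟩ : ∃ f : N ⟶ P, x = Ext.mk₀ f := ⟨Ext.addEquiv₀ x, (Ext.mk₀_addEquiv₀_apply x).symm⟩
  have h1 : Ext.addEquiv₀ (Ext.mk₀ f) = f := by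
    rw [← Ext.addEquiv₀_symm_apply, AddEquiv.apply_symm_apply]
  have h2 : Ext.addEquiv₀ (Ext.mk₀ ((pullD k φ).map f)) = (pullD k φ).map f := by
    rw [← Ext.addEquiv₀_symm_apply, AddEquiv.apply_symm_apply]
  simp only [curryExt₀, AddEquiv.trans_apply, curryHomAddEquiv_apply, Ext.mapExactFunctor_mk₀, h1, h2,
    Ext.addEquiv₀_symm_apply, Ext.mk₀_comp_mk₀, pullD_map_curryHom]
  -- the two sides now differ only by the definitional unfolding `φ^* (triv k) = triv k`
  rfl

omit [TopologicalSpace k] [CompactSpace Γ] [CompactSpace H] in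
/-- **`φ^* Hom(N, I•) ≅ Hom(φ^*N, φ^*I•)` as cochain complexes** (componentwise `pullIhomIso`).
[cite: Harari2020, §16.2 Definition 16.11 and §4.3 (2)] -/
def pullIhomComplexIso (I : CochainComplex (DiscreteRepCat k Γ) ℕ) :
    AcyclicResolution.mapComplex (pullD k φ)
        (((ihomFunctor N).mapHomologicalComplex (ComplexShape.up ℕ)).obj I) ≅
      ((ihomFunctor ((pullD k φ).obj N)).mapHomologicalComplex (ComplexShape.up ℕ)).obj
        (AcyclicResolution.mapComplex (pullD k φ) I) :=
  HomologicalComplex.Hom.isoOfComponents (fun n => pullIhomIso φ N (I.X n)) (fun i j _ =>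
    pullD_map_ihomFunctor_map φ N (I.d i j))

omit [TopologicalSpace k] [CompactSpace Γ] [CompactSpace H] in
/-- Components of `pullIhomComplexIso`. [cite: Harari2020, §16.2 Definition 16.11] -/
@[simp]
theorem pullIhomComplexIso_hom_f (I : CochainComplex (DiscreteRepCat k Γ) ℕ) (n : ℕ) :
    (pullIhomComplexIso φ N I).hom.f n = (pullIhomIso φ N (I.X n)).hom := rfl

omit [TopologicalSpace k] [IsTopologicalGroup Γ] [CompactSpace Γ] [CompactSpace H] in
/-- `Ext⁰(Y, ·)` on cochain maps is functorial (the abbreviation `extComplexMap` unfolded once).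
[cite: Weibel1994, §2.4] -/
theorem extComplexMap_comp' (Y : DiscreteRepCat k H) {I I' I'' : CochainComplex (DiscreteRepCat k H) ℕ}
    (ψ : I ⟶ I') (ψ' : I' ⟶ I'') :
    AcyclicResolution.extComplexMap Y (ψ ≫ ψ') =
      AcyclicResolution.extComplexMap Y ψ ≫ AcyclicResolution.extComplexMap Y ψ' :=
  Functor.map_comp _ _ _

omit [CompactSpace Γ] [CompactSpace H] in
/-- `φ^*_*` on `Ext⁰(triv k, I•)`, with its target typed over `triv k ∈ C_H` (`= φ^* (triv k)`
definitionally; the ascription fixes the syntactic form once and for all). [cite: Harari2020, §4.3 (2)] -/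
abbrev extComplexTrivPullMapF (I : CochainComplex (DiscreteRepCat k Γ) ℕ) :
    AcyclicResolution.extComplex (triv (Γ := Γ) k) I ⟶
      AcyclicResolution.extComplex (triv (Γ := H) k) (AcyclicResolution.mapComplex (pullD k φ) I) :=
  AcyclicResolution.extComplexMapF (pullD k φ) (triv (Γ := Γ) k) I

omit [TopologicalSpace k] [CompactSpace Γ] [CompactSpace H] in
/-- **The curry isomorphism of `Ext⁰`-complexes commutes with pullback**: for a cochain complex `I` of
`C_Γ`, `φ^*_* ≫ curry_H = curry_Γ ≫ φ^*_* ≫ (iso)_*` as cochain maps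
`Ext⁰_{C_Γ}(N, I•) ⟶ Ext⁰_{C_H}(triv k, Hom(φ^*N, φ^*I•))`.
[cite: Harari2020, §16.2 Theorem 16.14 (proof, (16.2)) and §4.3 (2)] -/
theorem extComplexCurryIso_hom_resDHom (I : CochainComplex (DiscreteRepCat k Γ) ℕ) :
    AcyclicResolution.extComplexMapF (pullD k φ) N I ≫
        (extComplexCurryIso ((pullD k φ).obj N) (AcyclicResolution.mapComplex (pullD k φ) I)).hom =
      (extComplexCurryIso N I).hom ≫
        extComplexTrivPullMapF φ (((ihomFunctor N).mapHomologicalComplex (ComplexShape.up ℕ)).obj I) ≫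
        AcyclicResolution.extComplexMap (triv (Γ := H) k) (pullIhomComplexIso φ N I).hom := by
  ext n x
  change curryExt₀ ((pullD k φ).obj N) ((pullD k φ).obj (I.X n)) (x.mapExactFunctor (pullD k φ)) =
    ((curryExt₀ N (I.X n) x).mapExactFunctor (pullD k φ)).comp
      (Ext.mk₀ ((pullIhomComplexIso φ N I).hom.f n)) (add_zero 0)
  rw [pullIhomComplexIso_hom_f]
  exact (curryExt₀_resDHom φ N x).symm

end Curry

/-! ## §1b Coefficient maps given in `C_H`: `c : φ^*(stdBase X) ⟶ stdBase Y` read on the topological models -/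

section CoeffD

variable {X : TopRep.{u} k Γ} [DiscreteTopology X.V] (hX : IsDiscrete ((forgetTop k Γ).obj X))
  {Y : TopRep.{u} k H} [DiscreteTopology Y.V] (hY : IsDiscrete ((forgetTop k H).obj Y))
  (c : (pullD k φ).obj (stdBase X hX) ⟶ stdBase Y hY)

/-- **A morphism `c : φ^*(stdBase X) ⟶ stdBase Y` of `C_H`, read as a morphism `φ^*X ⟶ Y` of the (topologically
discrete) topological representations** — the inverse of `pullbackHomD` (`pullbackHomD_homOfPullbackD`), for consumers
whose coefficient maps live in `C_H`. [cite: Harari2020, §1.5 Definition 1.33] -/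
def homOfPullbackD : TopRep.res (φ : H →* Γ) X ⟶ Y :=
  TopRep.ofHom ⟨⟨c.hom.hom.toLinearMap, continuous_of_discreteTopology⟩, fun h =>
    ContinuousLinearMap.ext fun x => Rep.hom_comm_apply c.hom h x⟩

/-- Formula: `homOfPullbackD c` is `c` on vectors. [cite: Harari2020, §1.5 Definition 1.33] -/
@[simp]
theorem homOfPullbackD_hom_apply (x : X.V) : (homOfPullbackD φ hX hY c).hom x = c.hom.hom x := rfl

/-- `pullbackHomD (homOfPullbackD c) = c`. [cite: Harari2020, §1.5 Definition 1.33] -/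
@[simp]
theorem pullbackHomD_homOfPullbackD : pullbackHomD φ hX hY (homOfPullbackD φ hX hY c) = c :=
  ObjectProperty.hom_ext _ (Rep.hom_ext (DFunLike.ext _ _ fun _ => rfl))

end CoeffD

/-! ## §2 The two engines under pullback (via `θ`; no acyclicity of the pulled-back complexes) -/

section EngineSrc

variable (N : DiscreteRepCat k Γ)
  {X : TopRep.{u} k Γ} [DiscreteTopology X.V] (hX : IsDiscrete ((forgetTop k Γ).obj X))
  {Y : TopRep.{u} k H} [DiscreteTopology Y.V] (hY : IsDiscrete ((forgetTop k H).obj Y))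
  (f : TopRep.res (φ : H →* Γ) X ⟶ Y)

/-- The composite cochain map on the `N` side:
`Ext⁰_{C_Γ}(N, std•X) → Ext⁰_{C_H}(φ^*N, φ^* std•X) → Ext⁰_{C_H}(φ^*N, std•_H Y)`.
[cite: Harari2020, §4.3 Remark 4.24] -/
abbrev extComplexSrcPullMap :
    AcyclicResolution.extComplex N (stdComplex X hX) ⟶
      AcyclicResolution.extComplex ((pullD k φ).obj N) (stdComplex Y hY) :=
  AcyclicResolution.extComplexMapF (pullD k φ) N (stdComplex X hX) ≫
    AcyclicResolution.extComplexMap ((pullD k φ).obj N) (stdComplexPullbackMap φ hX hY f)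

variable (hN : ∀ n q (e : Ext N ((stdComplex X hX).X n) (q + 1)), e = 0)
  (hN' : ∀ n q (e : Ext ((pullD k φ).obj N) ((stdComplex Y hY).X n) (q + 1)), e = 0)

/-- **`extAddEquivStdHomology` commutes with pullback and coefficient change** (the engine on `std• X`
in the source `N`): `Hⁿ(src-map) (E_X x) = E_Y (f_* (φ^* x))`.  The middle complex `φ^* std•_Γ X` is
exact but not `Ext(φ^*N, –)`-acyclic, so the proof goes through the comparison map `θ`
(`homologyToExt_map`, `homologyToExt_naturality`); `hN`, `hN'` = door-c4's acyclicity inputs over `Γ`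
and over `H` only. [cite: Harari2020, §4.3 Remark 4.24 and §16.2 Theorem 16.14][cite: Weibel1994, Theorem 2.7.6] -/
theorem extAddEquivStdHomology_resDHom (n : ℕ) (x : Ext N (stdBase X hX) n) :
    (HomologicalComplex.homologyMap (extComplexSrcPullMap φ N hX hY f) n).hom
        (extAddEquivStdHomology N X hX hN n x) =
      extAddEquivStdHomology ((pullD k φ).obj N) Y hY hN' n
        ((x.mapExactFunctor (pullD k φ)).comp (Ext.mk₀ (pullbackHomD φ hX hY f)) (add_zero n)) := by
  haveI := AcyclicResolution.mono_map_augmentation (pullD k φ) (stdComplex X hX) (stdη X hX)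
  rw [HomologicalComplex.homologyMap_comp]
  change (HomologicalComplex.homologyMap (AcyclicResolution.extComplexMap ((pullD k φ).obj N)
      (stdComplexPullbackMap φ hX hY f)) n).hom
      ((HomologicalComplex.homologyMap (AcyclicResolution.extComplexMapF (pullD k φ) N
        (stdComplex X hX)) n).hom (extAddEquivStdHomology N X hX hN n x)) = _
  cases n with
  | zero =>
    have hA := AcyclicResolution.extAddEquivHomologyZero_map (pullD k φ) N
      (stdComplex X hX) (stdη X hX) (stdη_d X hX) (exact_stdη X hX) x
    have hB := AcyclicResolution.extAddEquivHomologyZero_naturality ((pullD k φ).obj N)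
      (stdComplexPullbackMap φ hX hY f) ((pullD k φ).map (stdη X hX))
      (AcyclicResolution.map_hη (pullD k φ) (stdComplex X hX) (stdη X hX) (stdη_d X hX))
      (AcyclicResolution.map_exact_augmentation (pullD k φ) (stdComplex X hX) (stdη X hX) (stdη_d X hX)
        (exact_stdη X hX))
      (stdη Y hY) (stdη_d Y hY) (exact_stdη Y hY) (pullbackHomD φ hX hY f) (stdη_pullback φ hX hY f)
      (x.mapExactFunctor (pullD k φ))
    exact (congrArg _ hA).trans hB
  | succ n =>
    have h1 : AcyclicResolution.homologyToExt N (stdComplex X hX) (stdComplex_exactAt_succ X hX)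
        (stdη X hX) (stdη_d X hX) (exact_stdη X hX) n (extAddEquivStdHomology N X hX hN (n + 1) x) = x :=
      AcyclicResolution.homologyToExt_extAddEquivHomologySucc N (stdComplex X hX)
        (stdComplex_exactAt_succ X hX) (stdη X hX) (stdη_d X hX) (exact_stdη X hX) hN n x
    have h2 := AcyclicResolution.homologyToExt_map (pullD k φ) N (stdComplex X hX)
      (stdComplex_exactAt_succ X hX) (stdη X hX) (stdη_d X hX) (exact_stdη X hX) n
      (extAddEquivStdHomology N X hX hN (n + 1) x)
    rw [h1] at h2
    have h3 := AcyclicResolution.homologyToExt_naturality ((pullD k φ).obj N)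
      (stdComplexPullbackMap φ hX hY f)
      (AcyclicResolution.map_exactAt (pullD k φ) (stdComplex X hX) (stdComplex_exactAt_succ X hX))
      (stdComplex_exactAt_succ Y hY) ((pullD k φ).map (stdη X hX))
      (AcyclicResolution.map_hη (pullD k φ) (stdComplex X hX) (stdη X hX) (stdη_d X hX))
      (AcyclicResolution.map_exact_augmentation (pullD k φ) (stdComplex X hX) (stdη X hX) (stdη_d X hX)
        (exact_stdη X hX))
      (stdη Y hY) (stdη_d Y hY) (exact_stdη Y hY) (pullbackHomD φ hX hY f) (stdη_pullback φ hX hY f) n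
      ((HomologicalComplex.homologyMap (AcyclicResolution.extComplexMapF (pullD k φ) N
        (stdComplex X hX)) (n + 1)).hom (extAddEquivStdHomology N X hX hN (n + 1) x))
    rw [h2] at h3
    exact ((AcyclicResolution.extAddEquivHomologySucc_homologyToExt ((pullD k φ).obj N) (stdComplex Y hY)
      (stdComplex_exactAt_succ Y hY) (stdη Y hY) (stdη_d Y hY) (exact_stdη Y hY) hN' n _).symm.trans
      (congrArg (extAddEquivStdHomology ((pullD k φ).obj N) Y hY hN' (n + 1)) h3))

end EngineSrc

section Engines

variable (N : DiscreteRepCat k Γ) [hNfin : Module.Finite k N.obj.V] [hNfin' : Module.Finite k ((pullD k φ).obj N).obj.V]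
  {X : TopRep.{u} k Γ} [DiscreteTopology X.V] (hX : IsDiscrete ((forgetTop k Γ).obj X))
  {Y : TopRep.{u} k H} [DiscreteTopology Y.V] (hY : IsDiscrete ((forgetTop k H).obj Y))
  (f : TopRep.res (φ : H →* Γ) X ⟶ Y)

/-- The coefficient map on `Hom`: `Hom(φ^*N, f) : φ^* Hom(N, X) = Hom(φ^*N, φ^*X) ⟶ Hom(φ^*N, Y)` in `C_H`.
[cite: Harari2020, §16.2 Definition 16.11 and §1.5 Definition 1.33] -/
abbrev ihomPullbackHomD : (pullD k φ).obj (ihomObj N (stdBase X hX)) ⟶ ihomObj ((pullD k φ).obj N) (stdBase Y hY) :=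
  (pullIhomIso φ N (stdBase X hX)).hom ≫ (ihomFunctor ((pullD k φ).obj N)).map (pullbackHomD φ hX hY f)

/-- The cochain map `Hom(φ^*N, φ^* std•_Γ X → std•_H Y)` in `C_H` (its source is `φ^* Hom(N, std•_Γ X)`,
definitionally). [cite: Harari2020, §4.3 Remark 4.24 and §16.2] -/
abbrev ihomStdComplexPullbackMap :
    AcyclicResolution.mapComplex (pullD k φ) (ihomStdComplex N X hX) ⟶
      ihomStdComplex ((pullD k φ).obj N) Y hY :=
  (pullIhomComplexIso φ N (stdComplex X hX)).hom ≫
    ((ihomFunctor ((pullD k φ).obj N)).mapHomologicalComplex (ComplexShape.up ℕ)).map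
      (stdComplexPullbackMap φ hX hY f)

/-- The augmentations of the `Hom` complexes are compatible:
`φ^* η_{Hom} ≫ (Hom pullback-map)⁰ = Hom(φ^*N, f) ≫ η_{Hom, H}`. [cite: Harari2020, §4.3 Remark 4.24] -/
theorem ihomStdη_pullback :
    (pullD k φ).map (ihomStdη N X hX) ≫ (ihomStdComplexPullbackMap φ N hX hY f).f 0 =
      ihomPullbackHomD φ N hX hY f ≫ ihomStdη ((pullD k φ).obj N) Y hY := by
  refine ObjectProperty.hom_ext _ (Rep.hom_ext (DFunLike.ext _ _
    fun (F : N.obj.V →ₗ[k] (stdBase X hX).obj.V) => LinearMap.ext fun a => ?_))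
  change (resolutionMap φ f (0 + 1)).hom ((TopRep.d X 0).hom (F a)) = (TopRep.d Y 0).hom (f.hom (F a))
  exact (DFunLike.congr_fun (congrArg TopRep.Hom.hom (resolutionMap_comp_d φ f 0)) (F a)).symm

/-- The composite cochain map on the `Hom` side:
`Ext⁰_{C_Γ}(k, Hom(N, std•X)) → Ext⁰_{C_H}(k, φ^* Hom(N, std•X)) → Ext⁰_{C_H}(k, Hom(φ^*N, std•_H Y))`.
[cite: Harari2020, §4.3 Remark 4.24] -/
abbrev extComplexIhomPullMap :
    AcyclicResolution.extComplex (triv (Γ := Γ) k) (ihomStdComplex N X hX) ⟶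
      AcyclicResolution.extComplex (triv (Γ := H) k) (ihomStdComplex ((pullD k φ).obj N) Y hY) :=
  extComplexTrivPullMapF φ (ihomStdComplex N X hX) ≫
    AcyclicResolution.extComplexMap (triv (Γ := H) k) (ihomStdComplexPullbackMap φ N hX hY f)

/-- **`extTrivIhomAddEquivHomology` commutes with pullback and coefficient change** (the engine on
`Hom(N, std•X)` in the source `triv k`; both ends are `Ext(k, –)`-acyclic by door-c4, the middle
complex `φ^* Hom(N, std•_Γ X)` is handled by `θ`). [cite: Harari2020, §4.3 Remark 4.24 and §16.2 Theorem 16.14][cite: Weibel1994, Theorem 2.7.6] -/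
theorem extTrivIhomAddEquivHomology_resDHom (n : ℕ) (y : Ext (triv (Γ := Γ) k) (ihomObj N (stdBase X hX)) n) :
    (HomologicalComplex.homologyMap (extComplexIhomPullMap φ N hX hY f) n).hom
        (extTrivIhomAddEquivHomology N X hX n y) =
      extTrivIhomAddEquivHomology ((pullD k φ).obj N) Y hY n
        ((y.mapExactFunctor (pullD k φ)).comp (Ext.mk₀ (ihomPullbackHomD φ N hX hY f)) (add_zero n)) := by
  haveI := mono_ihomStdη N X hX
  haveI := mono_ihomStdη ((pullD k φ).obj N) Y hY
  haveI := AcyclicResolution.mono_map_augmentation (pullD k φ) (ihomStdComplex N X hX) (ihomStdη N X hX)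
  rw [HomologicalComplex.homologyMap_comp]
  change (HomologicalComplex.homologyMap (AcyclicResolution.extComplexMap (triv (Γ := H) k)
      (ihomStdComplexPullbackMap φ N hX hY f)) n).hom
      ((HomologicalComplex.homologyMap (AcyclicResolution.extComplexMapF (pullD k φ) (triv (Γ := Γ) k)
        (ihomStdComplex N X hX)) n).hom (extTrivIhomAddEquivHomology N X hX n y)) = _
  cases n with
  | zero =>
    have hA := AcyclicResolution.extAddEquivHomologyZero_map (pullD k φ) (triv (Γ := Γ) k)
      (ihomStdComplex N X hX) (ihomStdη N X hX) (ihomStdη_d N X hX) (exact_ihomStdη N X hX) y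
    have hB := AcyclicResolution.extAddEquivHomologyZero_naturality (triv (Γ := H) k)
      (ihomStdComplexPullbackMap φ N hX hY f) ((pullD k φ).map (ihomStdη N X hX))
      (AcyclicResolution.map_hη (pullD k φ) (ihomStdComplex N X hX) (ihomStdη N X hX) (ihomStdη_d N X hX))
      (AcyclicResolution.map_exact_augmentation (pullD k φ) (ihomStdComplex N X hX) (ihomStdη N X hX)
        (ihomStdη_d N X hX) (exact_ihomStdη N X hX))
      (ihomStdη ((pullD k φ).obj N) Y hY) (ihomStdη_d ((pullD k φ).obj N) Y hY)
      (exact_ihomStdη ((pullD k φ).obj N) Y hY) (ihomPullbackHomD φ N hX hY f)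
      (ihomStdη_pullback φ N hX hY f) (y.mapExactFunctor (pullD k φ))
    exact (congrArg _ hA).trans hB
  | succ n =>
    have h1 : AcyclicResolution.homologyToExt (triv (Γ := Γ) k) (ihomStdComplex N X hX)
        (ihomStdComplex_exactAt_succ N X hX) (ihomStdη N X hX) (ihomStdη_d N X hX) (exact_ihomStdη N X hX) n
        (extTrivIhomAddEquivHomology N X hX (n + 1) y) = y :=
      AcyclicResolution.homologyToExt_extAddEquivHomologySucc (triv (Γ := Γ) k) (ihomStdComplex N X hX)
        (ihomStdComplex_exactAt_succ N X hX) (ihomStdη N X hX) (ihomStdη_d N X hX) (exact_ihomStdη N X hX)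
        (ext_triv_ihomStdComplex_X_eq_zero N X hX) n y
    have h2 : AcyclicResolution.homologyToExt (triv (Γ := H) k)
        (AcyclicResolution.mapComplex (pullD k φ) (ihomStdComplex N X hX))
        (AcyclicResolution.map_exactAt (pullD k φ) (ihomStdComplex N X hX) (ihomStdComplex_exactAt_succ N X hX))
        ((pullD k φ).map (ihomStdη N X hX))
        (AcyclicResolution.map_hη (pullD k φ) (ihomStdComplex N X hX) (ihomStdη N X hX) (ihomStdη_d N X hX))
        (AcyclicResolution.map_exact_augmentation (pullD k φ) (ihomStdComplex N X hX) (ihomStdη N X hX)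
          (ihomStdη_d N X hX) (exact_ihomStdη N X hX)) n
        ((HomologicalComplex.homologyMap (AcyclicResolution.extComplexMapF (pullD k φ) (triv (Γ := Γ) k)
          (ihomStdComplex N X hX)) (n + 1)).hom (extTrivIhomAddEquivHomology N X hX (n + 1) y)) =
        y.mapExactFunctor (pullD k φ) := by
      have h := AcyclicResolution.homologyToExt_map (pullD k φ) (triv (Γ := Γ) k) (ihomStdComplex N X hX)
        (ihomStdComplex_exactAt_succ N X hX) (ihomStdη N X hX) (ihomStdη_d N X hX) (exact_ihomStdη N X hX) n
        (extTrivIhomAddEquivHomology N X hX (n + 1) y)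
      rw [h1] at h
      exact h
    have h3 := AcyclicResolution.homologyToExt_naturality (triv (Γ := H) k)
      (ihomStdComplexPullbackMap φ N hX hY f)
      (AcyclicResolution.map_exactAt (pullD k φ) (ihomStdComplex N X hX) (ihomStdComplex_exactAt_succ N X hX))
      (ihomStdComplex_exactAt_succ ((pullD k φ).obj N) Y hY) ((pullD k φ).map (ihomStdη N X hX))
      (AcyclicResolution.map_hη (pullD k φ) (ihomStdComplex N X hX) (ihomStdη N X hX) (ihomStdη_d N X hX))
      (AcyclicResolution.map_exact_augmentation (pullD k φ) (ihomStdComplex N X hX) (ihomStdη N X hX)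
        (ihomStdη_d N X hX) (exact_ihomStdη N X hX))
      (ihomStdη ((pullD k φ).obj N) Y hY) (ihomStdη_d ((pullD k φ).obj N) Y hY)
      (exact_ihomStdη ((pullD k φ).obj N) Y hY) (ihomPullbackHomD φ N hX hY f)
      (ihomStdη_pullback φ N hX hY f) n
      ((HomologicalComplex.homologyMap (AcyclicResolution.extComplexMapF (pullD k φ) (triv (Γ := Γ) k)
        (ihomStdComplex N X hX)) (n + 1)).hom (extTrivIhomAddEquivHomology N X hX (n + 1) y))
    rw [h2] at h3
    exact ((AcyclicResolution.extAddEquivHomologySucc_homologyToExt (triv (Γ := H) k)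
      (ihomStdComplex ((pullD k φ).obj N) Y hY) (ihomStdComplex_exactAt_succ ((pullD k φ).obj N) Y hY)
      (ihomStdη ((pullD k φ).obj N) Y hY) (ihomStdη_d ((pullD k φ).obj N) Y hY)
      (exact_ihomStdη ((pullD k φ).obj N) Y hY)
      (ext_triv_ihomStdComplex_X_eq_zero ((pullD k φ).obj N) Y hY) n _).symm.trans
      (congrArg (extTrivIhomAddEquivHomology ((pullD k φ).obj N) Y hY (n + 1)) h3))

/-! ## §3 The comparison `extIhomAddEquiv` under pullback -/

variable (hN : ∀ n q (e : Ext N ((stdComplex X hX).X n) (q + 1)), e = 0)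
  (hN' : ∀ n q (e : Ext ((pullD k φ).obj N) ((stdComplex Y hY).X n) (q + 1)), e = 0)

/-- The curry square between the two composite pullback maps, on homology:
`Hⁿ(src-map) ≫ curry_H = curry_Γ ≫ Hⁿ(Hom-map)`. [cite: Harari2020, §16.2 Theorem 16.14 (proof) and §4.3 (2)] -/
theorem extComplexCurryHomologyIso_hom_pullMap (n : ℕ) :
    HomologicalComplex.homologyMap (extComplexSrcPullMap φ N hX hY f) n ≫
        (extComplexCurryHomologyIso ((pullD k φ).obj N) (stdComplex Y hY) n).hom =
      (extComplexCurryHomologyIso N (stdComplex X hX) n).hom ≫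
        HomologicalComplex.homologyMap (extComplexIhomPullMap φ N hX hY f) n := by
  change HomologicalComplex.homologyMap _ n ≫ HomologicalComplex.homologyMap _ n =
    HomologicalComplex.homologyMap _ n ≫ HomologicalComplex.homologyMap _ n
  rw [← HomologicalComplex.homologyMap_comp, ← HomologicalComplex.homologyMap_comp]
  congr 1
  rw [Category.assoc, extComplexCurryIso_hom_naturality ((pullD k φ).obj N) (stdComplexPullbackMap φ hX hY f),
    ← Category.assoc, extComplexCurryIso_hom_resDHom, Category.assoc, Category.assoc, ← extComplexMap_comp']

/-- **THE COMPARISON `Extⁿ_{C_Γ}(N, X) ≃+ Extⁿ_{C_Γ}(triv k, Hom(N, X))` COMMUTES WITH PULLBACK AND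
COEFFICIENT CHANGE**: `Hom(φ^*N, f)_* (φ^* (extIhomAddEquiv N X x)) = extIhomAddEquiv (φ^*N) Y (f_* (φ^* x))`
in `Extⁿ_{C_H}(triv k, Hom(φ^*N, Y))`, for EVERY continuous `φ : H →ₜ* Γ` (no acyclicity of the
pulled-back complexes). [cite: Harari2020, §16.2 Proposition 16.16 (b), §1.5 Definition 1.33 and §4.3 (2)] -/
theorem extIhomAddEquiv_resDHom (n : ℕ) (x : Ext N (stdBase X hX) n) :
    ((extIhomAddEquiv N X hX hN n x).mapExactFunctor (pullD k φ)).comp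
        (Ext.mk₀ (ihomPullbackHomD φ N hX hY f)) (add_zero n) =
      extIhomAddEquiv ((pullD k φ).obj N) Y hY hN' n
        ((x.mapExactFunctor (pullD k φ)).comp (Ext.mk₀ (pullbackHomD φ hX hY f)) (add_zero n)) := by
  set E := extTrivIhomAddEquivHomology N X hX n with hE
  set E' := extTrivIhomAddEquivHomology ((pullD k φ).obj N) Y hY n with hE'
  -- unfold both `extIhomAddEquiv`s and move the `std`-engine
  change ((E.symm ((extComplexCurryHomologyIso N (stdComplex X hX) n).addCommGroupIsoToAddEquiv
      (extAddEquivStdHomology N X hX hN n x))).mapExactFunctor (pullD k φ)).comp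
      (Ext.mk₀ (ihomPullbackHomD φ N hX hY f)) (add_zero n) =
    E'.symm ((extComplexCurryHomologyIso ((pullD k φ).obj N) (stdComplex Y hY) n).addCommGroupIsoToAddEquiv
      (extAddEquivStdHomology ((pullD k φ).obj N) Y hY hN' n
        ((x.mapExactFunctor (pullD k φ)).comp (Ext.mk₀ (pullbackHomD φ hX hY f)) (add_zero n))))
  rw [← extAddEquivStdHomology_resDHom φ N hX hY f hN hN' n x]
  -- the curry square on homology, applied to the element
  have hsq := congrArg (fun g => g.hom (extAddEquivStdHomology N X hX hN n x))
    (extComplexCurryHomologyIso_hom_pullMap φ N hX hY f n)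
  change (extComplexCurryHomologyIso ((pullD k φ).obj N) (stdComplex Y hY) n).addCommGroupIsoToAddEquiv
      ((HomologicalComplex.homologyMap (extComplexSrcPullMap φ N hX hY f) n).hom
        (extAddEquivStdHomology N X hX hN n x)) =
    (HomologicalComplex.homologyMap (extComplexIhomPullMap φ N hX hY f) n).hom
      ((extComplexCurryHomologyIso N (stdComplex X hX) n).addCommGroupIsoToAddEquiv
        (extAddEquivStdHomology N X hX hN n x)) at hsq
  rw [hsq]
  -- the `Hom`-engine square in inverse form
  apply E'.injective
  rw [AddEquiv.apply_symm_apply, ← extTrivIhomAddEquivHomology_resDHom φ N hX hY f n,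
    AddEquiv.apply_symm_apply]

/-! ## §4 Composed with `Extⁿ(triv k, ·) ≃+ Hⁿ_cont`: the comparison `Extⁿ_{C_Γ}(N, X) ≃+ Hⁿ_cont(Γ, Hom(N, X))` -/

variable {YΓ : TopRep.{u} k Γ} [DiscreteTopology YΓ.V] (hYΓ : IsDiscrete ((forgetTop k Γ).obj YΓ))
  (eΓ : stdBase YΓ hYΓ ≅ ihomObj N (stdBase X hX))
  {YH : TopRep.{u} k H} [DiscreteTopology YH.V] (hYH : IsDiscrete ((forgetTop k H).obj YH))
  (eH : stdBase YH hYH ≅ ihomObj ((pullD k φ).obj N) (stdBase Y hY))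
  (g : TopRep.res (φ : H →* Γ) YΓ ⟶ YH)
  (hg : pullbackHomD φ hYΓ hYH g ≫ eH.hom = (pullD k φ).map eΓ.hom ≫ ihomPullbackHomD φ N hX hY f)

include hg in
/-- **THE COMPARISON `Extⁿ_{C_Γ}(N, X) ≃+ Hⁿ_cont(Γ, Hom(N, X))` COMMUTES WITH PULLBACK AND COEFFICIENT
CHANGE.**  Let `YΓ ≅ Hom(N, X)` in `C_Γ` (`eΓ`) and `YH ≅ Hom(φ^*N, Y)` in `C_H` (`eH`) be topological
models and `g : φ^*YΓ ⟶ YH` the map of topological representations corresponding to `Hom(φ^*N, f)`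
(`hg`).  Then for `x ∈ Extⁿ_{C_Γ}(N, X)`:
`Hⁿ(φ, g) (cmp_X x) = cmp_Y (f_* (φ^* x))`, with `Hⁿ(φ, g)` Mathlib's `ContinuousCohomology.map φ g n`
and `cmp` door-c4's `extIhomAddEquivContinuousCohomology` (under its acyclicity inputs `hN` over `Γ`,
`hN'` over `H`). [cite: Harari2020, §16.2 Proposition 16.16 (b), §1.5 Definition 1.33 and §4.3 (2)][cite: MilneADT2006, I §0 Example 0.8] -/
theorem extIhomAddEquivContinuousCohomology_resDHom (n : ℕ) (x : Ext N (stdBase X hX) n) :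
    (ContinuousCohomology.map φ g n).hom (extIhomAddEquivContinuousCohomology N X hX hN YΓ hYΓ eΓ n x) =
      extIhomAddEquivContinuousCohomology ((pullD k φ).obj N) Y hY hN' YH hYH eH n
        ((x.mapExactFunctor (pullD k φ)).comp (Ext.mk₀ (pullbackHomD φ hX hY f)) (add_zero n)) := by
  -- the two morphism identities behind the bookkeeping: `φ^*(eΓ⁻¹) ≫ g = Hom(φ^*N, f) ≫ eH⁻¹`
  have key : ((AcyclicResolution.extAddEquivOfIso (triv (Γ := Γ) k) eΓ.symm n
        (extIhomAddEquiv N X hX hN n x)).mapExactFunctor (pullD k φ)).comp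
        (Ext.mk₀ (pullbackHomD φ hYΓ hYH g)) (add_zero n) =
      ((((extIhomAddEquiv N X hX hN n x).mapExactFunctor (pullD k φ)).comp
        (Ext.mk₀ (ihomPullbackHomD φ N hX hY f)) (add_zero n)).comp (Ext.mk₀ eH.inv) (add_zero n)) := by
    rw [AcyclicResolution.extAddEquivOfIso_apply, Ext.mapExactFunctor_comp, Ext.mapExactFunctor_mk₀,
      Ext.comp_assoc_of_second_deg_zero, Ext.comp_assoc_of_second_deg_zero, Ext.mk₀_comp_mk₀,
      Ext.mk₀_comp_mk₀]
    congr 2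
    rw [Iso.symm_hom, ← cancel_mono eH.hom, Category.assoc, Category.assoc, Iso.inv_hom_id,
      Category.comp_id, hg, ← (pullD k φ).map_comp_assoc, Iso.inv_hom_id, (pullD k φ).map_id,
      Category.id_comp]
  have h1 := extTrivAddEquivContinuousCohomology_resDHom φ hYΓ hYH g n
    (AcyclicResolution.extAddEquivOfIso (triv (Γ := Γ) k) eΓ.symm n (extIhomAddEquiv N X hX hN n x))
  change (ContinuousCohomology.map φ g n).hom (extTrivAddEquivContinuousCohomology YΓ hYΓ n
      (AcyclicResolution.extAddEquivOfIso (triv k) eΓ.symm n (extIhomAddEquiv N X hX hN n x))) =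
    extTrivAddEquivContinuousCohomology YH hYH n (AcyclicResolution.extAddEquivOfIso (triv k) eH.symm n
      (extIhomAddEquiv ((pullD k φ).obj N) Y hY hN' n
        ((x.mapExactFunctor (pullD k φ)).comp (Ext.mk₀ (pullbackHomD φ hX hY f)) (add_zero n))))
  refine h1.trans (congrArg (extTrivAddEquivContinuousCohomology YH hYH n) ?_)
  -- (stated with `Eq.trans`/`congrArg` rather than `rw`: the two sides agree only up to the
  -- definitional, non-reducible identification `φ^*(triv k) = triv k`)
  exact key.trans (congrArg (fun z => z.comp (Ext.mk₀ eH.inv) (add_zero n))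
    (extIhomAddEquiv_resDHom φ N hX hY f hN hN' n x))

end Engines

end DiscreteRep

end Literature.Algebra.Homology
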